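import Mathlib
import HarnessLib
import Summits.Ventures.LatticeQCDFlow.Scoring.DoeblinGreenKubo
import Summits.Ventures.LatticeQCDFlow.Exactness.WilsonHeatBathErgodic

/-!
# The heat-bath sweep is minorised BY ITS GIBBS LAW: `|ρ_t| ≤ (1 − ε)ᵗ` and
# `τ_int ≤ (M/m)^{|l|+1} − 1/2` for every bounded observable (a qualitative certificate)

HONEST FRAMING: exact (Metropolis-corrected) sampling algorithms for lattice gauge theory;
figures of merit are autocorrelation/cost numbers at stated couplings and volumes; no
continuum-physics claim.

Venture `LatticeQCDFlow` (cell pub-lqcd), topic `Scoring`; FANOUT row 8 (`s0-cpn-nemc`, GEN-11).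
NEW WORK of the cell (one comparison of measures and a composition), not a published result: row
9's Doeblin minorisation of the heat-bath sweep by the PRODUCT law
(`Exactness/HeatBathSweepErgodic.lean`: `heatBathSweep_minorised`, `K(ω,·) ≥ (m/M)^{|l|} ⊗μ` for a
joint density `m ≤ p ≤ M`) is turned into a minorisation by the INVARIANT Gibbs law itself
(`⊗μ ≥ (Z/M)·π`, `Z = ∫ p d⊗μ ≥ m`), which is the hypothesis of row 8's kernel-level autocorrelation
envelope (`Scoring/DoeblinAutocorrelation.lean`: `abs_autocov_le_of_doeblin`, `tauInt_le_of_doeblin`,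
no reversibility needed — the sweep is not reversible).  Printed counterparts NAMED ONLY in the
files composed (Roberts–Polson 1994; Meyn–Tweedie 1993).  Nothing is cited as a fact.

## What is proved (finite product `Π_i X_i` of probability spaces `(X_i, μ_i)`, measurable joint
## density `m ≤ p ≤ M` with `0 < m`, `M < ∞`; `π = piGibbsLaw μ p`; `K` = the heat-bath scan over a
## list `l` visiting every site; `f` bounded measurable `π`-centred; `ρ(t) = C_f(t)/C_f(0)`)

* `pi_ge_piGibbsLaw` — `(∫p d⊗μ)·M⁻¹ · π(B) ≤ ⊗μ(B)`;
  **`heatBathSweep_minorised_by_piGibbsLaw`** — `K(ω, B) ≥ (m/M)^{|l|}·(Z/M) · π(B)` and the cruder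
  `heatBathSweep_minorised_by_piGibbsLaw'` — `K(ω, B) ≥ (m/M)^{|l|+1} · π(B)`, from EVERY
  configuration (Doeblin by the invariant law);
* **`heatBathSweep_autocorrelation`** — `|C_f(t)| ≤ (1 − ((m/M)^{|l|+1}))ᵗ · Var_π f` for all `t`
  and `τ_int(f) ≤ (M/m)^{|l|+1} − 1/2`, for EVERY bounded measurable centred observable;
  **`heatBathSweep_comp_autocorrelation`** — the same for the engine's composite sweep `η ∘ₖ K`
  with ANY Markov `η` leaving `π` invariant (over-relaxation sweeps);
* **`wilson_heatBathSweep_tauInt_le`** — torus Wilson theory with a continuous representation of a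
  compact group, bounds `a ≤ β S_W ≤ b`: every bounded measurable observable centred under the
  Wilson measure has `τ_int ≤ e^{(b − a)(|l|+1)} − 1/2` under the single-link heat-bath scan.

Reading (markdown): the production samplers' streams (U(1)/SU(2) heat bath + over-relaxation) have,
at every finite volume and coupling, a CERTIFIED finite integrated autocorrelation time for every
bounded observable — a qualitative certificate (the constant `(M/m)^{|l|+1}` is astronomically
large), recorded so that the kernel-level vocabulary covers all three S0 sampler families; useful
autocorrelation numbers are MEASURED (the scorers).  NOT CLAIMED: any useful rate; SU(N ≥ 3)
Cabibbo–Marinari hits (row 9's caveat); HMC; unbounded fields.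
-/

noncomputable section

namespace Summit.Ventures.LatticeQCDFlow.Scoring

open MeasureTheory ProbabilityTheory Filter Function Summit.Ventures.LatticeQCDFlow.Exactness
open scoped ENNReal Topology

section Product

variable {ι : Type*} [Fintype ι] [DecidableEq ι] {X : ι → Type*} [∀ i, MeasurableSpace (X i)]
variable {μ : Π i, Measure (X i)} [∀ i, IsProbabilityMeasure (μ i)] {p : (Π j, X j) → ℝ≥0∞}
variable {m M : ℝ≥0∞}

omit [DecidableEq ι] in
/-- The product law dominates a multiple of the Gibbs law: `(∫ p d⊗μ)·M⁻¹ · π(B) ≤ ⊗μ(B)`. -/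
theorem pi_ge_piGibbsLaw (hm0 : m ≠ 0) (hMtop : M ≠ ∞) (hmp : ∀ ω, m ≤ p ω) (hpM : ∀ ω, p ω ≤ M)
    {B : Set (Π j, X j)} (hB : MeasurableSet B) :
    (∫⁻ ω, p ω ∂Measure.pi μ) * M⁻¹ * piGibbsLaw μ p B ≤ Measure.pi μ B := by
  haveI : ∀ i, Nonempty (X i) := fun i => nonempty_of_isProbabilityMeasure (μ i)
  set Z := ∫⁻ ω, p ω ∂Measure.pi μ with hZ
  have hlow : m ≤ Z := by
    calc m = ∫⁻ _, m ∂Measure.pi μ := by rw [lintegral_const, measure_univ, mul_one]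
      _ ≤ Z := lintegral_mono fun ω => hmp ω
  have hup : Z ≤ M := by
    calc Z ≤ ∫⁻ _, M ∂Measure.pi μ := lintegral_mono fun ω => hpM ω
      _ = M := by rw [lintegral_const, measure_univ, mul_one]
  have hZ0 : Z ≠ 0 := (lt_of_lt_of_le (pos_iff_ne_zero.2 hm0) hlow).ne'
  have hZtop : Z ≠ ∞ := ne_top_of_le_ne_top hMtop hup
  have hM0 : M ≠ 0 := (lt_of_lt_of_le (pos_iff_ne_zero.2 hm0) (hlow.trans hup)).ne'
  have hB' : ∫⁻ ω in B, p ω ∂Measure.pi μ ≤ M * Measure.pi μ B := by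
    calc ∫⁻ ω in B, p ω ∂Measure.pi μ ≤ ∫⁻ _ in B, M ∂Measure.pi μ := lintegral_mono fun ω => hpM ω
      _ = M * Measure.pi μ B := by rw [setLIntegral_const]
  rw [piGibbsLaw, Measure.smul_apply, smul_eq_mul, withDensity_apply _ hB]
  calc Z * M⁻¹ * (Z⁻¹ * ∫⁻ ω in B, p ω ∂Measure.pi μ)
      ≤ Z * M⁻¹ * (Z⁻¹ * (M * Measure.pi μ B)) := by gcongr
    _ = (Z * Z⁻¹) * (M⁻¹ * M) * Measure.pi μ B := by ring
    _ = Measure.pi μ B := by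
        rw [ENNReal.mul_inv_cancel hZ0 hZtop, ENNReal.inv_mul_cancel hM0 hMtop, one_mul, one_mul]

/-- **Doeblin BY THE GIBBS LAW for the heat-bath sweep**: from every configuration,
`K(ω, B) ≥ (m/M)^{|l|} · (Z/M) · π(B)`, `Z = ∫ p d⊗μ`. -/
theorem heatBathSweep_minorised_by_piGibbsLaw (hp : Measurable p) (hm0 : m ≠ 0) (hMtop : M ≠ ∞)
    (hmp : ∀ ω, m ≤ p ω) (hpM : ∀ ω, p ω ≤ M) {l : List ι} (hl : ∀ i, i ∈ l) (ω : Π j, X j)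
    {B : Set (Π j, X j)} (hB : MeasurableSet B) :
    (m * M⁻¹) ^ l.length * ((∫⁻ ω, p ω ∂Measure.pi μ) * M⁻¹) * piGibbsLaw μ p B
      ≤ cycle (l.map (siteHeatBath μ p)) ω B := by
  have h1 := Measure.le_iff.1 (heatBathSweep_minorised (μ := μ) hp hm0 hMtop hmp hpM hl ω) B hB
  rw [Measure.smul_apply, smul_eq_mul] at h1
  calc (m * M⁻¹) ^ l.length * ((∫⁻ ω, p ω ∂Measure.pi μ) * M⁻¹) * piGibbsLaw μ p B
      = (m * M⁻¹) ^ l.length * ((∫⁻ ω, p ω ∂Measure.pi μ) * M⁻¹ * piGibbsLaw μ p B) := by ring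
    _ ≤ (m * M⁻¹) ^ l.length * Measure.pi μ B :=
        mul_le_mul' le_rfl (pi_ge_piGibbsLaw hm0 hMtop hmp hpM hB)
    _ ≤ cycle (l.map (siteHeatBath μ p)) ω B := h1

/-- The cruder constant: `K(ω, B) ≥ (m/M)^{|l|+1} · π(B)` (`Z ≥ m`). -/
theorem heatBathSweep_minorised_by_piGibbsLaw' (hp : Measurable p) (hm0 : m ≠ 0) (hMtop : M ≠ ∞)
    (hmp : ∀ ω, m ≤ p ω) (hpM : ∀ ω, p ω ≤ M) {l : List ι} (hl : ∀ i, i ∈ l) (ω : Π j, X j)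
    {B : Set (Π j, X j)} (hB : MeasurableSet B) :
    (m * M⁻¹) ^ (l.length + 1) * piGibbsLaw μ p B ≤ cycle (l.map (siteHeatBath μ p)) ω B := by
  haveI : ∀ i, Nonempty (X i) := fun i => nonempty_of_isProbabilityMeasure (μ i)
  have hlow : m ≤ ∫⁻ ω, p ω ∂Measure.pi μ := by
    calc m = ∫⁻ _, m ∂Measure.pi μ := by rw [lintegral_const, measure_univ, mul_one]
      _ ≤ _ := lintegral_mono fun ω => hmp ω
  refine le_trans ?_ (heatBathSweep_minorised_by_piGibbsLaw hp hm0 hMtop hmp hpM hl ω hB)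
  rw [pow_succ]
  exact mul_le_mul' (mul_le_mul' le_rfl (mul_le_mul' hlow le_rfl)) le_rfl

/-- Real form of the crude constant: `((m/M)^{n}).toReal = (m.toReal/M.toReal)^n` and its inverse. -/
theorem toReal_crudeConst (n : ℕ) :
    ((m * M⁻¹) ^ n).toReal = (m.toReal / M.toReal) ^ n := by
  rw [ENNReal.toReal_pow, ENNReal.toReal_mul, ENNReal.toReal_inv, div_eq_mul_inv]

/-- **Every bounded observable of the heat-bath sweep: envelope and `τ_int` ceiling.**  With
`ε = (m/M)^{|l|+1}`: `|C_f(t)| ≤ (1 − ε)ᵗ · ∫ f² dπ` for all `t` and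
`τ_int(f) ≤ (M/m)^{|l|+1} − 1/2`, for every bounded measurable `π`-centred `f`. -/
theorem heatBathSweep_autocorrelation (hp : Measurable p) (hm0 : m ≠ 0) (hMtop : M ≠ ∞)
    (hmp : ∀ ω, m ≤ p ω) (hpM : ∀ ω, p ω ≤ M) {l : List ι} (hl : ∀ i, i ∈ l)
    {f : (Π j, X j) → ℝ} (hf : Measurable f) {C : ℝ} (hC : ∀ ω, |f ω| ≤ C)
    (hf0 : ∫ ω, f ω ∂(piGibbsLaw μ p) = 0) :
    (∀ t : ℕ, |autocov (cycle (l.map (siteHeatBath μ p))) (piGibbsLaw μ p) f t|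
        ≤ (1 - (m.toReal / M.toReal) ^ (l.length + 1)) ^ t * ∫ ω, f ω ^ 2 ∂(piGibbsLaw μ p)) ∧
      tauInt (fun t => autocov (cycle (l.map (siteHeatBath μ p))) (piGibbsLaw μ p) f t
          / autocov (cycle (l.map (siteHeatBath μ p))) (piGibbsLaw μ p) f 0)
        ≤ (M.toReal / m.toReal) ^ (l.length + 1) - 1 / 2 := by
  haveI := isMarkovKernel_heatBathSweep (μ := μ) hp hm0 hMtop hmp hpM l
  haveI := isProbabilityMeasure_piGibbsLaw (μ := μ) (p := p) hm0 hMtop hmp hpM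
  have hinv := heatBathSweep_invariant_piGibbsLaw (μ := μ) hp hm0 hMtop hmp hpM l
  have hmin : ∀ x {B : Set (Π j, X j)}, MeasurableSet B →
      (m * M⁻¹) ^ (l.length + 1) * piGibbsLaw μ p B ≤ cycle (l.map (siteHeatBath μ p)) x B :=
    fun x B hB => heatBathSweep_minorised_by_piGibbsLaw' hp hm0 hMtop hmp hpM hl x hB
  have hε0 : 0 < (m * M⁻¹) ^ (l.length + 1) :=
    ENNReal.pow_pos (ENNReal.mul_pos hm0 (ENNReal.inv_ne_zero.2 hMtop)) _
  refine ⟨fun t => ?_, ?_⟩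
  · have h := abs_autocov_le_of_doeblin hinv hmin hf hC hf0 t
    rwa [toReal_crudeConst] at h
  · have h := tauInt_le_of_doeblin hinv hmin hε0 hf hC hf0
    rwa [toReal_crudeConst, one_div, ← inv_pow, inv_div] at h

/-- **… and of the composite sweep `η ∘ₖ K`** for any Markov `η` leaving `π` invariant
(over-relaxation sweeps, exact reflections): the minorisation by `π` survives the composition. -/
theorem heatBathSweep_comp_autocorrelation (hp : Measurable p) (hm0 : m ≠ 0) (hMtop : M ≠ ∞)
    (hmp : ∀ ω, m ≤ p ω) (hpM : ∀ ω, p ω ≤ M) {l : List ι} (hl : ∀ i, i ∈ l)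
    (η : Kernel (Π j, X j) (Π j, X j)) [IsMarkovKernel η]
    (hη : Kernel.Invariant η (piGibbsLaw μ p))
    {f : (Π j, X j) → ℝ} (hf : Measurable f) {C : ℝ} (hC : ∀ ω, |f ω| ≤ C)
    (hf0 : ∫ ω, f ω ∂(piGibbsLaw μ p) = 0) :
    (∀ t : ℕ, |autocov (η ∘ₖ cycle (l.map (siteHeatBath μ p))) (piGibbsLaw μ p) f t|
        ≤ (1 - (m.toReal / M.toReal) ^ (l.length + 1)) ^ t * ∫ ω, f ω ^ 2 ∂(piGibbsLaw μ p)) ∧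
      tauInt (fun t => autocov (η ∘ₖ cycle (l.map (siteHeatBath μ p))) (piGibbsLaw μ p) f t
          / autocov (η ∘ₖ cycle (l.map (siteHeatBath μ p))) (piGibbsLaw μ p) f 0)
        ≤ (M.toReal / m.toReal) ^ (l.length + 1) - 1 / 2 := by
  haveI := isMarkovKernel_heatBathSweep (μ := μ) hp hm0 hMtop hmp hpM l
  haveI := isProbabilityMeasure_piGibbsLaw (μ := μ) (p := p) hm0 hMtop hmp hpM
  have hinvK := heatBathSweep_invariant_piGibbsLaw (μ := μ) hp hm0 hMtop hmp hpM l
  have hinv : Kernel.Invariant (η ∘ₖ cycle (l.map (siteHeatBath μ p))) (piGibbsLaw μ p) :=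
    hη.comp hinvK
  -- minorisation by `π` as measures, then through `η`
  have hmeas : ∀ a, (m * M⁻¹) ^ (l.length + 1) • piGibbsLaw μ p
      ≤ cycle (l.map (siteHeatBath μ p)) a := fun a =>
    Measure.le_iff.2 fun B hB => by
      rw [Measure.smul_apply, smul_eq_mul]
      exact heatBathSweep_minorised_by_piGibbsLaw' hp hm0 hMtop hmp hpM hl a hB
  have hcomp := fun a => minorised_comp_left hmeas η a
  have hbind : (piGibbsLaw μ p).bind η = piGibbsLaw μ p := hη.def
  have hmin : ∀ x {B : Set (Π j, X j)}, MeasurableSet B →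
      (m * M⁻¹) ^ (l.length + 1) * piGibbsLaw μ p B
        ≤ (η ∘ₖ cycle (l.map (siteHeatBath μ p))) x B := fun x B hB => by
    have h := Measure.le_iff.1 (hcomp x) B hB
    rwa [hbind, Measure.smul_apply, smul_eq_mul] at h
  have hε0 : 0 < (m * M⁻¹) ^ (l.length + 1) :=
    ENNReal.pow_pos (ENNReal.mul_pos hm0 (ENNReal.inv_ne_zero.2 hMtop)) _
  refine ⟨fun t => ?_, ?_⟩
  · have h := abs_autocov_le_of_doeblin hinv hmin hf hC hf0 t
    rwa [toReal_crudeConst] at h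
  · have h := tauInt_le_of_doeblin hinv hmin hε0 hf hC hf0
    rwa [toReal_crudeConst, one_div, ← inv_pow, inv_div] at h

end Product

/-! ### The torus Wilson theory -/

section Wilson

open Literature.MathematicalPhysics.QuantumFieldTheory

variable {d L N : ℕ} {G : Type*} [Group G] [TopologicalSpace G] [IsTopologicalGroup G]
  [CompactSpace G] [MeasurableSpace G] [BorelSpace G] [SecondCountableTopology G]
  (ρ : G →* Matrix (Fin N) (Fin N) ℂ)

/-- **Every bounded observable of the Wilson heat-bath link sweep has a certified finite `τ_int`.**
Torus Wilson theory with a continuous representation `ρ` of a compact group, bounds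
`a ≤ β S_W ≤ b` on the scaled action: for every scan `l` of single-link heat baths visiting every
edge and every bounded measurable observable `f` centred under the Wilson measure,
`τ_int(f) ≤ e^{(b − a)(|l|+1)} − 1/2` (and `|ρ_t| ≤ (1 − e^{−(b−a)(|l|+1)})ᵗ`). -/
theorem wilson_heatBathSweep_tauInt_le [NeZero L] (hρ : Continuous ρ) (β : ℝ) {a b : ℝ}
    (ha : ∀ U : GaugeConfig d L G, a ≤ β * wilsonAction ρ U)
    (hb : ∀ U : GaugeConfig d L G, β * wilsonAction ρ U ≤ b)
    {l : List (Edge d L)} (hl : ∀ e, e ∈ l) {f : GaugeConfig d L G → ℝ} (hf : Measurable f)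
    {C : ℝ} (hC : ∀ U, |f U| ≤ C) (hf0 : ∫ U, f U ∂(wilsonMeasure ρ β) = 0) :
    (∀ t : ℕ, |autocov (cycle (l.map (siteHeatBath (fun _ : Edge d L => haarProbability G)
          (gibbsDensity fun U : GaugeConfig d L G => β * wilsonAction ρ U)))) (wilsonMeasure ρ β) f t|
        ≤ (1 - Real.exp (-((b - a) * (l.length + 1)))) ^ t * ∫ U, f U ^ 2 ∂(wilsonMeasure ρ β)) ∧
      tauInt (fun t => autocov (cycle (l.map (siteHeatBath (fun _ : Edge d L => haarProbability G)
          (gibbsDensity fun U : GaugeConfig d L G => β * wilsonAction ρ U)))) (wilsonMeasure ρ β) f t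
          / autocov (cycle (l.map (siteHeatBath (fun _ : Edge d L => haarProbability G)
          (gibbsDensity fun U : GaugeConfig d L G => β * wilsonAction ρ U)))) (wilsonMeasure ρ β) f 0)
        ≤ Real.exp ((b - a) * (l.length + 1)) - 1 / 2 := by
  have hS : Continuous fun U : GaugeConfig d L G => β * wilsonAction ρ U :=
    continuous_smul_wilsonAction ρ hρ β
  rw [wilsonMeasure_eq_piGibbsLaw] at hf0 ⊢
  have h := heatBathSweep_autocorrelation (μ := fun _ : Edge d L => haarProbability G)
    (p := gibbsDensity fun U : GaugeConfig d L G => β * wilsonAction ρ U) (measurable_gibbsDensity hS)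
    (m := ENNReal.ofReal (Real.exp (-b))) (M := ENNReal.ofReal (Real.exp (-a)))
    (by rw [Ne, ENNReal.ofReal_eq_zero, not_le]; exact Real.exp_pos _) ENNReal.ofReal_ne_top
    (fun ω => (gibbsDensity_bounds ha hb ω).1) (fun ω => (gibbsDensity_bounds ha hb ω).2) hl hf hC hf0
  have hq : (ENNReal.ofReal (Real.exp (-b))).toReal / (ENNReal.ofReal (Real.exp (-a))).toReal
      = Real.exp (-(b - a)) := by
    rw [ENNReal.toReal_ofReal (Real.exp_pos _).le, ENNReal.toReal_ofReal (Real.exp_pos _).le,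
      ← Real.exp_sub]
    ring_nf
  have hq' : (ENNReal.ofReal (Real.exp (-a))).toReal / (ENNReal.ofReal (Real.exp (-b))).toReal
      = Real.exp (b - a) := by
    rw [ENNReal.toReal_ofReal (Real.exp_pos _).le, ENNReal.toReal_ofReal (Real.exp_pos _).le,
      ← Real.exp_sub]
    ring_nf
  have e1 : Real.exp (-(b - a)) ^ (l.length + 1) = Real.exp (-((b - a) * (l.length + 1))) := by
    rw [← Real.exp_nat_mul]; congr 1; push_cast; ring
  have e2 : Real.exp (b - a) ^ (l.length + 1) = Real.exp ((b - a) * (l.length + 1)) := by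
    rw [← Real.exp_nat_mul]; congr 1; push_cast; ring
  rw [hq, hq', e1, e2] at h
  exact h

end Wilson

end Summit.Ventures.LatticeQCDFlow.Scoring

end
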